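import Summits.NavierStokesRegularity.NavierStokesRegularity.Theorems.LerayQuarterDissipationFiniteDissipationLiouvilleVorticityAlignment
import Literature.Analysis.FluidPDE.BarkerPrange2020VorticityAlignmentTypeIHolds
import HarnessLib

/-!
# Crux `FiniteDissipationLiouville` (stmt-NavierStokesRegularity-22144): the LOCAL
# direction-coherence leaf — alignment of the vorticity on ANY open set at one instant kills a
# finite-dissipation Type-I profile; the direction-oscillation floor holds in EVERY similarity ball

Theorems file of route `LerayQuarterDissipation` (lead prover ns-lqd-lead g8; `--supports` the
crux, line `birth`; portrait facts for the registered stub `stub_envelopeCriticalLiouville`).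
Navier–Stokes regularity is NOT proved by anything here; no summit is.

Localisation of `…VorticityAlignment` by the SPACE ANALYTICITY of the slices
(`IsTypeIAncientMild.analyticOnNhd_slice_univ`) through the tree's globalisation lemma
`curl_parallel_of_parallel_on_open` (Barker–Prange 2020 file, deviation (D1): alignment on a
non-empty open set ⇒ alignment everywhere):

* `slice_eq_zero_of_curl_parallel_on_open` — a member of `𝒟_{C,K}` whose vorticity at ONE instant
  is parallel to one fixed line on SOME non-empty open set vanishes at that instant;
* `false_of_alignedDirection_seq_local` — compactness core with a FIXED similarity radius `r`;
* `directionCoherence_leaf_local` — **for all `C, K` and every `r > 0` there is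
  `δ = δ(C,K,r) > 0` such that `δ`-coherence MODULO SIGN of `ξ = ω/|ω|` on the `δ`-large-vorticity
  part of the similarity ball `B(0, r√(−t))` at ONE instant forces boundedness at the apex**;
* `directionOscillation_floor_local` — **every singular member has, at EVERY instant and in EVERY
  similarity ball `B(0, r√(−t))` (any `r > 0`), two points with `(−t)|ω| > δ(C,K,r)` whose
  vorticity directions are `δ`-apart modulo sign** — the direction oscillation of a
  finite-dissipation Type-I singularity concentrates AT the singular point.

Nearest in-tree antecedents (acknowledged): `Literature.….translationInvariant_of_curl_parallel`
and `not_isBackwardSingularPoint_of_typeIAncientMild_of_curl_parallel_slice` (Barker–Prange 2020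
Prop. 4 / Remark 5, one aligned slice of a Type-I ancient mild SUITABLE WEAK solution with finite
Type-I bound ⇒ regular, via forward propagation, a second zoom and KNSS Thm 6.2) and
`Theorems.unidirectionalVorticityLiouville` (ClockStretchingLaw line: alignment at ALL times). The
delta here: the finite-dissipation class (law instead of the suitable-weak apparatus; `L⁶` slices
make one aligned slice vanish directly), SIGN-BLIND coherence, ONE similarity ball of ANY radius
with a UNIFORM tolerance `δ(C,K,r)`, and the every-instant floor as a portrait clause of the crux.

HONEST FRAMING. `δ(C,K,r)` by compactness; portrait fact; no DSS scenario with three-dimensional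
vorticity is removed.

References: Barker–Prange 2020 (ARMA 235), Prop. 4, Rmk. 5, Thm. 3; Giga–Miura 2011, Thm 2.10;
Koch–Nadirashvili–Seregin–Šverák 2009, §4; Lemarié-Rieusset 2016, Thm. 9.12 (analyticity).
-/

noncomputable section

-- the summit and its single sub-problem share the name (CONVENTIONS §1), as in every Theorems file
set_option linter.dupNamespace false

namespace Summit.NavierStokesRegularity.NavierStokesRegularity.Theorems.FiniteDissipationLiouville.VorticityAlignment

open MeasureTheory Set Filter Topology Metric Function
open Literature.Analysis Literature.Analysis.FluidPDE
open Summit.NavierStokesRegularity.NavierStokesRegularity.Theorems.FiniteDissipationLiouville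
open scoped ENNReal NNReal RealInnerProductSpace

/-! ### Alignment on an open set -/

/-- **A member of `𝒟_{C,K}` whose vorticity at ONE instant is parallel to one fixed line on SOME
non-empty open set vanishes at that instant** (analytic globalisation
`curl_parallel_of_parallel_on_open`, then `slice_eq_zero_of_curl_parallel`).
[cite: BarkerPrange2020Alignment, Prop. 4 and Remark 5 (arXiv:1906.08225 p. 5)] [cite: LemarieRieusset2016, Thm. 9.12] -/
theorem slice_eq_zero_of_curl_parallel_on_open {C K : ℝ}
    {w : ℝ → EuclideanSpace ℝ (Fin 3) → EuclideanSpace ℝ (Fin 3)}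
    (hw : IsTypeIAncientMild C w)
    (hlaw : ∀ s : ℝ, s < 0 → ∫⁻ x, ‖fderiv ℝ (w s) x‖ₑ ^ 2 ≤ ENNReal.ofReal (K / Real.sqrt (-s)))
    {s : ℝ} (hs : s < 0) {S : Set (EuclideanSpace ℝ (Fin 3))} (hS : IsOpen S) (hne : S.Nonempty)
    (e : EuclideanSpace ℝ (Fin 3)) (hpar : ∀ x ∈ S, ∃ c : ℝ, curl (w s) x = c • e) :
    ∀ x, w s x = 0 :=
  slice_eq_zero_of_curl_parallel hw hlaw hs e
    (curl_parallel_of_parallel_on_open (hw.analyticOnNhd_slice_univ hs) hS hne hpar)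

/-! ### The local compactness core -/

/-- **No sequence of singular members of `𝒟_{C,K}` has asymptotically aligned vorticity directions
(mod sign) on a FIXED ball `B(0, r)` above vanishing levels at `t = −1`.** The KNSS limit has
either an irrotational slice on `B(0,r)` (then it vanishes: `QuietVorticity`) or a point of `B(0,r)`
with non-zero vorticity, around which — on the open set `{ω ≠ 0} ∩ B(0,r)` — the vorticity is
parallel to one line; analyticity globalises, and the slice vanishes. [cite: KochNadirashviliSereginSverak2009, §4 (arXiv:0709.3599 p. 8)] [cite: BarkerPrange2020Alignment, Prop. 4 (arXiv:1906.08225 p. 5)] -/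
theorem false_of_alignedDirection_seq_local {C K r : ℝ} (hr : 0 < r)
    {w : ℕ → ℝ → EuclideanSpace ℝ (Fin 3) → EuclideanSpace ℝ (Fin 3)}
    (hwk : ∀ k, IsTypeIAncientMild C (w k))
    (hlaw : ∀ k, ∀ s : ℝ, s < 0 →
      ∫⁻ x, ‖fderiv ℝ (w k s) x‖ₑ ^ 2 ≤ ENNReal.ofReal (K / Real.sqrt (-s)))
    (hsing : ∀ k, ∀ ρ > 0, ∀ M : ℝ, ∃ t ∈ Ioo (-(ρ ^ 2)) (0 : ℝ),
      ∃ x ∈ ball (0 : EuclideanSpace ℝ (Fin 3)) ρ, M < ‖w k t x‖)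
    (halign : ∀ k : ℕ, ∀ x ∈ ball (0 : EuclideanSpace ℝ (Fin 3)) r,
      ∀ y ∈ ball (0 : EuclideanSpace ℝ (Fin 3)) r,
        1 / ((k : ℝ) + 1) < ‖curl (w k (-1)) x‖ → 1 / ((k : ℝ) + 1) < ‖curl (w k (-1)) y‖ →
        min ‖vorticityDirection (curl (w k (-1))) x - vorticityDirection (curl (w k (-1))) y‖
            ‖vorticityDirection (curl (w k (-1))) x + vorticityDirection (curl (w k (-1))) y‖ ≤
          1 / ((k : ℝ) + 1)) :
    False := by
  obtain ⟨ψ, hψ, W, hW, hunif, -, hgrad⟩ := Compactness.seqLimit hwk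
  have hψt : Tendsto ψ atTop atTop := hψ.tendsto_atTop
  have hWlaw : ∀ s : ℝ, s < 0 →
      ∫⁻ x, ‖fderiv ℝ (W s) x‖ₑ ^ 2 ≤ ENNReal.ofReal (K / Real.sqrt (-s)) :=
    Compactness.law_of_seqLimit (Kinf := K) (Kk := fun _ => K) hψt hlaw
      (fun ε hε => Eventually.of_forall fun _ => by linarith) hgrad
  have hWsing := Compactness.persistent_singularity_seq (w := fun j => w (ψ j))
    (fun j => hwk (ψ j)) (fun j => hlaw (ψ j)) (fun j => hsing (ψ j)) hW hunif
  have h1 : (-1 : ℝ) < 0 := by norm_num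
  have hcurl : ∀ z, Tendsto (fun j => curl (w (ψ j) (-1)) z) atTop (𝓝 (curl (W (-1)) z)) := by
    intro z
    simp only [curl_eq_curlCLM]
    exact ((curlCLM).continuous.tendsto _).comp (hgrad (-1) h1 z)
  have hδ : Tendsto (fun j => 1 / ((ψ j : ℝ) + 1)) atTop (𝓝 0) :=
    (tendsto_one_div_add_atTop_nhds_zero_nat (𝕜 := ℝ)).comp hψt
  have hev_level : ∀ z : EuclideanSpace ℝ (Fin 3), curl (W (-1)) z ≠ 0 → ∀ᶠ j in atTop,
      1 / ((ψ j : ℝ) + 1) < ‖curl (w (ψ j) (-1)) z‖ := by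
    intro z hz
    have hpos : 0 < ‖curl (W (-1)) z‖ / 2 := by positivity
    have h2 : ∀ᶠ j in atTop, ‖curl (W (-1)) z‖ / 2 < ‖curl (w (ψ j) (-1)) z‖ :=
      ((hcurl z).norm).eventually (lt_mem_nhds (by linarith [norm_pos_iff.2 hz]))
    filter_upwards [h2, hδ.eventually (gt_mem_nhds hpos)] with j hj hj'
    exact hj'.trans hj
  -- Case A: the limit slice is irrotational on `B(0,r)` ⇒ zero slice
  by_cases hA : ∀ z ∈ ball (0 : EuclideanSpace ℝ (Fin 3)) r, curl (W (-1)) z = 0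
  · exact CalmSlice.not_singular_of_zero_slice hW h1
      (QuietVorticity.slice_eq_zero_of_curl_eq_zero_on_ball hW hWlaw h1 hr hA) hWsing
  -- Case B: a point of `B(0,r)` with non-zero limit vorticity fixes the direction `e`
  push Not at hA
  obtain ⟨z₀, hz₀r, hz₀⟩ := hA
  set e : EuclideanSpace ℝ (Fin 3) := vorticityDirection (curl (W (-1))) z₀ with he_def
  -- the open set where the limit vorticity does not vanish, inside the ball
  set S : Set (EuclideanSpace ℝ (Fin 3)) :=
    {z | curl (W (-1)) z ≠ 0} ∩ ball (0 : EuclideanSpace ℝ (Fin 3)) r with hS_def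
  have hcontcurl : Continuous (curl (W (-1))) := by
    rw [curl_eq_curlCLM_comp]
    exact curlCLM.continuous.comp
      (((hW.contDiff_slice h1).of_le (WithTop.coe_le_coe.2 le_top) : ContDiff ℝ 1 (W (-1))).continuous_fderiv
        one_ne_zero)
  have hS : IsOpen S := (isOpen_ne_fun hcontcurl continuous_const).inter isOpen_ball
  have hSne : S.Nonempty := ⟨z₀, hz₀, hz₀r⟩
  have hparS : ∀ z ∈ S, ∃ c : ℝ, curl (W (-1)) z = c • e := by
    rintro z ⟨hz, hzr⟩
    have hξz : Tendsto (fun j => vorticityDirection (curl (w (ψ j) (-1))) z) atTop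
        (𝓝 (vorticityDirection (curl (W (-1))) z)) := by
      simp only [vorticityDirection_apply]
      exact tendsto_unitDir (hcurl z) hz
    have hξz₀ : Tendsto (fun j => vorticityDirection (curl (w (ψ j) (-1))) z₀) atTop (𝓝 e) := by
      rw [he_def]
      simp only [vorticityDirection_apply]
      exact tendsto_unitDir (hcurl z₀) hz₀
    have hmin : Tendsto (fun j =>
        min ‖vorticityDirection (curl (w (ψ j) (-1))) z - vorticityDirection (curl (w (ψ j) (-1))) z₀‖
          ‖vorticityDirection (curl (w (ψ j) (-1))) z + vorticityDirection (curl (w (ψ j) (-1))) z₀‖)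
        atTop (𝓝 (min ‖vorticityDirection (curl (W (-1))) z - e‖
          ‖vorticityDirection (curl (W (-1))) z + e‖)) :=
      ((hξz.sub hξz₀).norm).min ((hξz.add hξz₀).norm)
    have hle : ∀ᶠ j in atTop,
        min ‖vorticityDirection (curl (w (ψ j) (-1))) z - vorticityDirection (curl (w (ψ j) (-1))) z₀‖
          ‖vorticityDirection (curl (w (ψ j) (-1))) z + vorticityDirection (curl (w (ψ j) (-1))) z₀‖ ≤
          1 / ((ψ j : ℝ) + 1) := by
      filter_upwards [hev_level z hz, hev_level z₀ hz₀] with j hl hl₀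
      exact halign (ψ j) z hzr z₀ hz₀r hl hl₀
    have hmin0 : min ‖vorticityDirection (curl (W (-1))) z - e‖
        ‖vorticityDirection (curl (W (-1))) z + e‖ ≤ 0 := le_of_tendsto_of_tendsto hmin hδ hle
    have hωz : curl (W (-1)) z = ‖curl (W (-1)) z‖ • vorticityDirection (curl (W (-1))) z := by
      rw [vorticityDirection_apply, smul_smul, mul_inv_cancel₀ (norm_ne_zero_iff.2 hz), one_smul]
    rcases le_total ‖vorticityDirection (curl (W (-1))) z - e‖
        ‖vorticityDirection (curl (W (-1))) z + e‖ with hc | hc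
    · rw [min_eq_left hc] at hmin0
      have : vorticityDirection (curl (W (-1))) z = e :=
        sub_eq_zero.1 (norm_le_zero_iff.1 hmin0)
      refine ⟨‖curl (W (-1)) z‖, ?_⟩
      conv_lhs => rw [hωz, this]
    · rw [min_eq_right hc] at hmin0
      have : vorticityDirection (curl (W (-1))) z = -e :=
        eq_neg_of_add_eq_zero_left (norm_le_zero_iff.1 hmin0)
      refine ⟨-‖curl (W (-1)) z‖, ?_⟩
      conv_lhs => rw [hωz, this]
      rw [smul_neg, neg_smul]
  exact CalmSlice.not_singular_of_zero_slice hW h1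
    (slice_eq_zero_of_curl_parallel_on_open hW hWlaw h1 hS hSne e hparS) hWsing

/-! ### The local leaf and the local floor -/

/-- **LOCAL ONE-SLICE DIRECTION-COHERENCE LEAF.** For all `C, K` and every similarity radius
`r > 0` there is `δ = δ(C,K,r) > 0` such that a member of `𝒟_{C,K}` having ONE instant `t < 0` at
which `min(‖ξ(x) − ξ(y)‖, ‖ξ(x) + ξ(y)‖) ≤ δ` for all `x, y ∈ B(0, r√(−t))` with
`(−t)‖ω(t,·)‖ > δ` is bounded on some backward cylinder at the origin.
[cite: GigaMiura2011, Thm 2.10 (HUPS preprint #956 p. 10)] [cite: BarkerPrange2020Alignment, Thm. 3 (arXiv:1906.08225 p. 18)] -/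
theorem directionCoherence_leaf_local : ∀ (C K r : ℝ), 0 < r → ∃ δ > 0,
    ∀ (w : ℝ → EuclideanSpace ℝ (Fin 3) → EuclideanSpace ℝ (Fin 3)),
      IsTypeIAncientMild C w →
      (∀ s : ℝ, s < 0 → ∫⁻ x, ‖fderiv ℝ (w s) x‖ₑ ^ 2 ≤ ENNReal.ofReal (K / Real.sqrt (-s))) →
      (∃ t < 0, ∀ x ∈ ball (0 : EuclideanSpace ℝ (Fin 3)) (r * Real.sqrt (-t)),
        ∀ y ∈ ball (0 : EuclideanSpace ℝ (Fin 3)) (r * Real.sqrt (-t)),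
          δ < (-t) * ‖curl (w t) x‖ → δ < (-t) * ‖curl (w t) y‖ →
          min ‖vorticityDirection (curl (w t)) x - vorticityDirection (curl (w t)) y‖
              ‖vorticityDirection (curl (w t)) x + vorticityDirection (curl (w t)) y‖ ≤ δ) →
      ¬ (∀ ρ > 0, ∀ M : ℝ, ∃ t ∈ Ioo (-(ρ ^ 2)) (0 : ℝ),
        ∃ x ∈ ball (0 : EuclideanSpace ℝ (Fin 3)) ρ, M < ‖w t x‖) := by
  intro C K r hr
  by_contra hcon
  push Not at hcon
  choose w' hw' hlaw' hq' hsing' using hcon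
  choose t' ht' hq' using hq'
  have hpos : ∀ k : ℕ, (0 : ℝ) < 1 / ((k : ℝ) + 1) := fun k => by positivity
  set w : ℕ → ℝ → EuclideanSpace ℝ (Fin 3) → EuclideanSpace ℝ (Fin 3) :=
    fun k => w' _ (hpos k) with hw_def
  have hw : ∀ k, IsTypeIAncientMild C (w k) := fun k => hw' _ (hpos k)
  have hlaw := fun k => hlaw' _ (hpos k)
  have hsing := fun k => hsing' _ (hpos k)
  set t : ℕ → ℝ := fun k => t' _ (hpos k) with ht_def
  have ht : ∀ k, t k < 0 := fun k => ht' _ (hpos k)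
  have hq := fun k => hq' _ (hpos k)
  set c : ℕ → ℝ := fun k => Real.sqrt (-t k) with hc_def
  have hc : ∀ k, 0 < c k := fun k => Real.sqrt_pos.2 (neg_pos.2 (ht k))
  have hc2 : ∀ k, c k ^ 2 = -t k := fun k => Real.sq_sqrt (neg_nonneg.2 (ht k).le)
  set v : ℕ → ℝ → EuclideanSpace ℝ (Fin 3) → EuclideanSpace ℝ (Fin 3) :=
    fun k => nsRescale (c k) (w k) with hv_def
  have hv : ∀ k, IsTypeIAncientMild C (v k) := fun k => isTypeIAncientMild_nsRescale (hw k) (hc k)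
  have hvlaw : ∀ k, ∀ s : ℝ, s < 0 →
      ∫⁻ x, ‖fderiv ℝ (v k s) x‖ₑ ^ 2 ≤ ENNReal.ofReal (K / Real.sqrt (-s)) :=
    fun k => RecurrentReductionD.dissipationLaw_nsRescale (hlaw k) (hc k)
  have hvsing : ∀ k, ∀ ρ > 0, ∀ M : ℝ, ∃ t ∈ Ioo (-(ρ ^ 2)) (0 : ℝ),
      ∃ x ∈ ball (0 : EuclideanSpace ℝ (Fin 3)) ρ, M < ‖v k t x‖ :=
    fun k => RecurrentReductionD.singularAtOrigin_nsRescale (hsing k) (hc k)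
  have e1 : ∀ k, c k ^ 2 * (-1 : ℝ) = t k := fun k => by rw [hc2]; ring
  have hball : ∀ k : ℕ, ∀ z ∈ ball (0 : EuclideanSpace ℝ (Fin 3)) r,
      c k • z ∈ ball (0 : EuclideanSpace ℝ (Fin 3)) (r * Real.sqrt (-t k)) := by
    intro k z hz
    rw [mem_ball_zero_iff] at hz ⊢
    rw [norm_smul, Real.norm_of_nonneg (hc k).le, hc_def, mul_comm]
    exact mul_lt_mul_of_pos_right hz (hc k)
  have hnorm : ∀ (k : ℕ) (z : EuclideanSpace ℝ (Fin 3)),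
      ‖curl (v k (-1)) z‖ = (-t k) * ‖curl (w k (t k)) (c k • z)‖ := by
    intro k z
    rw [hv_def]
    dsimp only
    rw [QuietVorticity.curl_nsRescale, e1, norm_smul, Real.norm_of_nonneg (mul_self_nonneg _),
      ← sq, hc2]
  have hdir : ∀ (k : ℕ) (z : EuclideanSpace ℝ (Fin 3)), vorticityDirection (curl (v k (-1))) z =
      vorticityDirection (curl (w k (t k))) (c k • z) := by
    intro k z
    rw [hv_def]
    dsimp only
    rw [vorticityDirection_nsRescale (hc k), e1]
  have halign : ∀ k : ℕ, ∀ x ∈ ball (0 : EuclideanSpace ℝ (Fin 3)) r,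
      ∀ y ∈ ball (0 : EuclideanSpace ℝ (Fin 3)) r,
        1 / ((k : ℝ) + 1) < ‖curl (v k (-1)) x‖ → 1 / ((k : ℝ) + 1) < ‖curl (v k (-1)) y‖ →
        min ‖vorticityDirection (curl (v k (-1))) x - vorticityDirection (curl (v k (-1))) y‖
            ‖vorticityDirection (curl (v k (-1))) x + vorticityDirection (curl (v k (-1))) y‖ ≤
          1 / ((k : ℝ) + 1) := by
    intro k x hx y hy hlx hly
    rw [hnorm] at hlx hly
    rw [hdir, hdir]
    exact hq k (c k • x) (hball k x hx) (c k • y) (hball k y hy) hlx hly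
  exact false_of_alignedDirection_seq_local hr hv hvlaw hvsing halign

/-- **LOCAL DIRECTION-OSCILLATION FLOOR** (portrait clause of the registered stub
`stub_envelopeCriticalLiouville`): for all `C, K` and every similarity radius `r > 0` there is
`δ = δ(C,K,r) > 0` such that every SINGULAR member of `𝒟_{C,K}` has, at EVERY instant `t < 0`,
two points of `B(0, r√(−t))` with scaled vorticity `> δ` whose vorticity directions are `δ`-apart
modulo sign — the direction oscillation concentrates at the singular point, in every similarity
ball around the axis. [cite: GigaMiura2011, Thm 2.10 (HUPS preprint #956 p. 10)] [cite: KochNadirashviliSereginSverak2009, §4 (arXiv:0709.3599 p. 8)] -/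
theorem directionOscillation_floor_local : ∀ (C K r : ℝ), 0 < r → ∃ δ > 0,
    ∀ (w : ℝ → EuclideanSpace ℝ (Fin 3) → EuclideanSpace ℝ (Fin 3)),
      IsTypeIAncientMild C w →
      (∀ s : ℝ, s < 0 → ∫⁻ x, ‖fderiv ℝ (w s) x‖ₑ ^ 2 ≤ ENNReal.ofReal (K / Real.sqrt (-s))) →
      (∀ ρ > 0, ∀ M : ℝ, ∃ t ∈ Ioo (-(ρ ^ 2)) (0 : ℝ),
        ∃ x ∈ ball (0 : EuclideanSpace ℝ (Fin 3)) ρ, M < ‖w t x‖) →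
      ∀ t < 0, ∃ x ∈ ball (0 : EuclideanSpace ℝ (Fin 3)) (r * Real.sqrt (-t)),
        ∃ y ∈ ball (0 : EuclideanSpace ℝ (Fin 3)) (r * Real.sqrt (-t)),
          δ < (-t) * ‖curl (w t) x‖ ∧ δ < (-t) * ‖curl (w t) y‖ ∧
          δ < ‖vorticityDirection (curl (w t)) x - vorticityDirection (curl (w t)) y‖ ∧
          δ < ‖vorticityDirection (curl (w t)) x + vorticityDirection (curl (w t)) y‖ := by
  intro C K r hr
  obtain ⟨δ, hδ, h⟩ := directionCoherence_leaf_local C K r hr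
  refine ⟨δ, hδ, fun w hw hlaw hsing t ht => ?_⟩
  by_contra hcon
  push Not at hcon
  refine h w hw hlaw ⟨t, ht, fun x hx y hy hlx hly => ?_⟩ hsing
  rcases le_or_gt ‖vorticityDirection (curl (w t)) x - vorticityDirection (curl (w t)) y‖ δ
    with h1 | h1
  · exact (min_le_left _ _).trans h1
  · exact (min_le_right _ _).trans (hcon x hx y hy hlx hly h1)

end Summit.NavierStokesRegularity.NavierStokesRegularity.Theorems.FiniteDissipationLiouville.VorticityAlignment

end
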